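import Summits.KontsevichZagierPeriods.KontsevichZagierPeriods.Theorems.RealEllipticSectorKernel.Negative.Ovals
import Summits.KontsevichZagierPeriods.KontsevichZagierPeriods.Theorems.RealEllipticSectorKernel.Negative.IsogenyCM66
import Literature.NumberTheory.Transcendental.KZSubcalculusInvariants
import Summits.KontsevichZagierPeriods.KontsevichZagierPeriods.Theorems.GenusTwoCycleTransfer.Negative.Witnesses

/-!
# `RealEllipticSectorKernel` (stmt-KontsevichZagierPeriods-10632), negative side: the rational CM point `j = 66³`

cdisprove finding F9 (commentary in `Cruxes/RealEllipticSectorKernel/Disproof.lean` §9). On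
`y² = 4x³ − 44x + 56` (`(q₂,q₃) = (44,−56)`, `Δ = 512`, CM by `ℤ[2i]`) the crux's periods satisfy the
INTEGER relation `J₀ = 2K₀` (`J₀_eq_two_mul_K₀_cm`; both in closed form, `J₀_cm`, `K₀_cm`), proved
by the rational 2-isogeny of `Negative/IsogenyCM66.lean`. Consequences:
* `not_rigidity_cm`, `not_qRigidity_cm`: the crux's inlined rigidity AND its `ℚ`-sharpening
  (`Negative.QRigidity`, all the intended proof consumes) FAIL here — the crux and `Negative.Sharpened`
  are vacuous at this curve although `q₃ ≠ 0`;
* `not_intIndependent_off_mirror`: REFUTED STRENGTHENING — integer relations between `J₀` and `K₀`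
  are not confined to the mirror family `q₃ = 0` of `Negative.K₀_eq_J₀_of_q₃_zero`;
* `cmElem` = `[σ,1/√f] − 2[σ′,1/√(−f)]` is an honest kernel element (`eval_cmElem`) which is in
  neither sub-calculus (`cmElem_not_mem_closure_cov_nl`: `coeffSum = −1`;
  `cmElem_not_mem_closure_add`: `restrictedEval ≠ 0`) and is a relation if the summit holds
  (`cmElem_mem_relations_of_summit`): an isogeny-transfer the route has no support item for
  (its CMTwist supports are `j = 8000` only).

Sources: M. Kontsevich, D. Zagier, *Periods* (2001), §§1.1–1.2; J. Vélu, *Isogénies entre courbes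
elliptiques*, C. R. Acad. Sci. Paris 273 (1971) 238–241; D. Masser, *Elliptic Functions and
Transcendence*, LNM 437 (1975), Ch. III. -/

noncomputable section

namespace Summit.KontsevichZagierPeriods.RealEllipticSectorKernel.CMPoint

open MeasureTheory Set
open Literature.NumberTheory.Transcendental Literature.ModelTheory.ExponentialFields
open Summit.KontsevichZagierPeriods.RealEllipticSectorKernel.Negative
open Summit.KontsevichZagierPeriods.RealEllipticSectorKernel.Ovals
open Summit.KontsevichZagierPeriods.HermiteRigidity.GenusTwoCycleTransferNegative (setIntegral_fin_one)

open CM66 in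
/-- The crux's cubic at `(44, −56)` is `CM66.fcm`. [folklore] -/
theorem cubic_cm (x : ℝ) : cubic 44 (-56) x = CM66.fcm x := by
  simp only [cubic, CM66.fcm]; push_cast; ring

/-- `Δ(44,−56) = 512 > 0`. [folklore] -/
theorem discr_cm_pos : 0 < discr 44 (-56) := by norm_num [discr]

/-- `σ(44,−56) = (e₃, e₂)` with `e₂,₃ = −1 ± 2√2`. [folklore] -/
theorem σ₁_cm : σ₁ 44 (-56) = {p | CM66.e₃ < p 0 ∧ p 0 < CM66.e₂} := by
  ext p
  simp only [σ₁, mem_setOf_eq, cubic_cm]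
  exact CM66.sigma_cm_iff (p 0)

/-- `σ'(44,−56) = (e₂, 2)`. [folklore] -/
theorem σ₂_cm : σ₂ 44 (-56) = {p | CM66.e₂ < p 0 ∧ p 0 < 2} := by
  ext p
  simp only [σ₂, mem_setOf_eq, cubic_cm]
  exact CM66.sigma'_cm_iff (p 0)

/-- **(F9)** `K₀(44,−56) = Γ(1/4)²/(8√(2π))`. [folklore] -/
theorem K₀_cm : K₀ 44 (-56) = CM66.lemHalf / 2 := by
  unfold K₀
  rw [σ₂_cm]
  have h := setIntegral_fin_one (fun x => 1 / Real.sqrt (-CM66.fcm x)) (Ioo CM66.e₂ 2)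
  simp only [mem_Ioo] at h
  simp only [cubic_cm]
  rw [h, ← CM66.integral_K_cm]
  refine integral_congr_ae (Filter.Eventually.of_forall fun x => ?_)
  simp only [one_div]

/-- **(F9)** `J₀(44,−56) = Γ(1/4)²/(4√(2π))`. [folklore] -/
theorem J₀_cm : J₀ 44 (-56) = CM66.lemHalf := by
  unfold J₀
  rw [σ₁_cm]
  have h := setIntegral_fin_one (fun x => 1 / Real.sqrt (CM66.fcm x)) (Ioo CM66.e₃ CM66.e₂)
  simp only [mem_Ioo] at h
  simp only [cubic_cm]
  rw [h, ← CM66.integral_J_cm]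
  refine integral_congr_ae (Filter.Eventually.of_forall fun x => ?_)
  simp only [one_div]

/-- **(F9) The integer period relation at `j = 66³`**: `J₀(44,−56) = 2·K₀(44,−56)`. [folklore] -/
theorem J₀_eq_two_mul_K₀_cm : J₀ 44 (-56) = 2 * K₀ 44 (-56) := by
  rw [J₀_cm, K₀_cm]; ring

/-- **(F9)** Hence the ℚ-rigidity of F4 fails at `(44,−56)` (`b = 1`, `d = −2`): `Sharpened` is
vacuous there. [folklore] -/
theorem not_qRigidity_cm : ¬ QRigidity 44 (-56) := by
  intro h
  have := h 1 0 (-2) 0 (by rw [J₀_eq_two_mul_K₀_cm]; push_cast; ring)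
  exact one_ne_zero this.1

/-- **(F9)** … and so does the crux's inlined hypothesis: the crux says nothing about
`y² = 4x³ − 44x + 56`. [folklore] -/
theorem not_rigidity_cm : ¬ Rigidity 44 (-56) := fun h => not_qRigidity_cm (qRigidity_of_rigidity h)

/-- **(F9) refuted strengthening**: integer relations between `J₀` and `K₀` are NOT confined to the
mirror family `q₃ = 0` (where `K₀ = J₀`, `Negative.K₀_eq_J₀_of_q₃_zero`) — witness `(44,−56)`,
`(m,n) = (1,−2)`. [folklore] -/
theorem not_intIndependent_off_mirror :
    ¬ ∀ q₂ q₃ : ℚ, 0 < discr q₂ q₃ → q₃ ≠ 0 →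
      ∀ m n : ℤ, (m : ℝ) * J₀ q₂ q₃ + (n : ℝ) * K₀ q₂ q₃ = 0 → m = 0 ∧ n = 0 := by
  intro h
  have := h 44 (-56) discr_cm_pos (by norm_num) 1 (-2)
    (by rw [J₀_eq_two_mul_K₀_cm]; push_cast; ring)
  exact one_ne_zero this.1

/-- The generator `[σ, 1/√f]` at `(44,−56)` as an honest representation (integrability from the
closed-form value). [folklore] -/
def genσCM : KZ.IntegralRep 1 where
  domain := σ₁ 44 (-56)
  integrand := fun p => 1 / Real.sqrt (cubic 44 (-56) (p 0))
  isSemialgebraic_domain := isSemialgebraic_σ₁ 44 (-56)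
  isSemialgebraicFunOn_integrand := isSemialgebraicFunOn_inv_sqrt_cubic 44 (-56)
  integrableOn := by
    by_contra h
    have h0 := integral_undef h
    have h1 : J₀ 44 (-56) = 0 := h0
    rw [J₀_cm] at h1
    exact absurd h1 (ne_of_gt CM66.lemHalf_pos)

/-- The generator `[σ', 1/√(−f)]` at `(44,−56)` as an honest representation. [folklore] -/
def genσ'CM : KZ.IntegralRep 1 where
  domain := σ₂ 44 (-56)
  integrand := fun p => 1 / Real.sqrt (-cubic 44 (-56) (p 0))
  isSemialgebraic_domain := isSemialgebraic_σ₂ 44 (-56)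
  isSemialgebraicFunOn_integrand := isSemialgebraicFunOn_inv_sqrt_neg_cubic 44 (-56)
  integrableOn := by
    by_contra h
    have h0 := integral_undef h
    have h1 : K₀ 44 (-56) = 0 := h0
    rw [K₀_cm] at h1
    exact absurd h1 (ne_of_gt (by linarith [CM66.lemHalf_pos]))

/-- Auxiliary step of the isogeny / two-torsion computation (F9–F10). [folklore] -/
theorem genσCM_value : genσCM.value = CM66.lemHalf := J₀_cm
/-- Auxiliary step of the isogeny / two-torsion computation (F9–F10). [folklore] -/
theorem genσ'CM_value : genσ'CM.value = CM66.lemHalf / 2 := K₀_cm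

/-- **The CM kernel element** `u₀ = [σ, 1/√f] − 2[σ', 1/√(−f)]` at `(44,−56)`. [folklore] -/
def cmElem : KZ.FormalRep := KZ.of genσCM - 2 • KZ.of genσ'CM

/-- Auxiliary step of the isogeny / two-torsion computation (F9–F10). [folklore] -/
theorem genσCM_mem_gens : KZ.of genσCM ∈ Gens 44 (-56) :=
  Or.inl (Or.inl ⟨genσCM, 0, rfl, fun p _ => by simp [genσCM], rfl⟩)

/-- Auxiliary step of the isogeny / two-torsion computation (F9–F10). [folklore] -/
theorem genσ'CM_mem_gens : KZ.of genσ'CM ∈ Gens 44 (-56) :=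
  Or.inl (Or.inr ⟨genσ'CM, 0, rfl, fun p _ => by simp [genσ'CM], rfl⟩)

/-- `u₀ ∈ closure S`. [folklore] -/
theorem cmElem_mem_closure : cmElem ∈ AddSubgroup.closure (Gens 44 (-56)) :=
  sub_mem (AddSubgroup.subset_closure genσCM_mem_gens)
    (AddSubgroup.nsmul_mem _ (AddSubgroup.subset_closure genσ'CM_mem_gens) 2)

/-- **(F9)** `eval u₀ = J₀ − 2K₀ = 0`: an honest kernel element at a curve where the crux is silent. [folklore] -/
theorem eval_cmElem : KZ.eval cmElem = 0 := by
  simp only [cmElem, map_sub, map_nsmul, KZ.eval_of, genσCM_value, genσ'CM_value]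
  simp only [nsmul_eq_mul, Nat.cast_ofNat]
  ring

/-- `u₀` has coefficient sum `−1`, so it is NOT in the subgroup generated by moves (2) + (3):
every derivation uses an additivity move. [folklore] -/
theorem cmElem_not_mem_closure_cov_nl :
    cmElem ∉ AddSubgroup.closure (KZ.changeOfVariablesRel ∪ KZ.newtonLeibnizRel) := by
  intro h
  have h0 := KZ.closure_cov_nl_le_ker_coeffSum h
  rw [AddMonoidHom.mem_ker] at h0
  simp [cmElem, map_sub, map_nsmul, KZ.coeffSum_of] at h0

/-- `u₀` has restricted value `J₀ ≠ 0` over the window `{f > 0}` … stated with the window family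
`A n = {p | ∀ i, cubic (p i) > 0}`; so it is NOT in the subgroup generated by the additivity moves
(1a) + (1b): every derivation uses a change of variables or a Newton–Leibniz move. [folklore] -/
theorem cmElem_not_mem_closure_add :
    cmElem ∉ AddSubgroup.closure (KZ.domainAddRel ∪ KZ.integrandAddRel) := by
  intro h
  set A : (n : ℕ) → Set (Fin n → ℝ) := fun n => {p | ∀ i, 0 < cubic 44 (-56) (p i)} with hA
  have hAm : ∀ n, MeasurableSet (A n) := by
    intro n
    have : A n = ⋂ i, {p : Fin n → ℝ | 0 < cubic 44 (-56) (p i)} := by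
      ext p; simp [hA]
    rw [this]
    refine MeasurableSet.iInter fun i => ?_
    exact measurableSet_lt measurable_const (by unfold cubic; fun_prop)
  have h0 := KZ.closure_add_le_ker_restrictedEval A hAm h
  rw [AddMonoidHom.mem_ker] at h0
  have h1 : genσCM.domain ∩ A 1 = genσCM.domain := by
    refine inter_eq_left.mpr fun p hp i => ?_
    rw [Fin.fin_one_eq_zero i]; exact hp.1
  have h2 : genσ'CM.domain ∩ A 1 = ∅ := by
    ext p
    simp only [mem_inter_iff, mem_empty_iff_false, iff_false, not_and]
    intro hp hA1
    exact absurd (hA1 0) (not_lt.mpr hp.1.le)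
  simp only [cmElem, map_sub, map_nsmul, KZ.restrictedEval_of, h1, h2, Measure.restrict_empty,
    integral_zero_measure, smul_zero, sub_zero] at h0
  have h3 : genσCM.value = 0 := h0
  rw [genσCM_value] at h3
  exact absurd h3 (ne_of_gt CM66.lemHalf_pos)

/-- **(F9)** The summit predicts `u₀ ∈ relations` (kernel form of Conjecture 1); the crux, being
vacuous at `(44,−56)`, predicts nothing. [folklore] -/
theorem cmElem_mem_relations_of_summit (h : _root_.KontsevichZagierPeriods) :
    cmElem ∈ KZ.relations :=
  (kzKernelConjecture_iff_isRational.mpr h) cmElem eval_cmElem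

end Summit.KontsevichZagierPeriods.RealEllipticSectorKernel.CMPoint

end
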